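import Summits.BirchSwinnertonDyer.BirchSwinnertonDyer.Theorems.ManinLocalTwoThreeLineIndexMonotone
import Literature.NumberTheory.EllipticCurves.PastenSpectralDegreeProofs
import HarnessLib

/-!
# The congruence number and all cut-lattice line indices of an elliptic-curve newform are FINITE (nonzero)

Summit `BirchSwinnertonDyer`, sub-problem `BirchSwinnertonDyer`, route `ManinLocalTwoThree`; width seat `bsd-line-manin23-p2`
(gen 9), `--supports` the crux C3 `ManinPrimeToThreeAtNine` (stmt-BirchSwinnertonDyer-22968).  Cell `bsd-f2-manin`, descent
lens: desc's rows carry guards `lineIndex … ≠ 0` / «finite index» (the tree's `lineIndex`, `congruenceNumber`, `planeIndex` are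
`Nat.card` of a quotient, `0` when infinite).  The tree's Pasten–Shimura machinery (`PastenSpectralDegreeProofs`,
`PastenCongruenceModulusProofs`, PROVED) gives `r_f ∣ ∏_{P ≠ 𝕀_f} η_f(P)` with a positive right-hand side for the newform of
every modular parametrisation datum; so `r_f ≠ 0`, and by monotonicity (`lineIndex_dvd_of_le`, sibling file) every line index
of a lattice containing `D.f` is nonzero.  Consequences recorded here: the guards disappear from the seat's E-desc-56 upper
half for twist pairs, and the Conway–Norton plane index of a same-conductor `(−3)`-twist pair is finite.

PROVED here (no `sorry`): **`congruenceNumber_ne_zero_of_datum`**, `lineIndex_ne_zero_of_mem`,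
`lineIndex_ramanujan_ne_zero`, `lineIndex_conway_ne_zero`, `lineIndex_al_ne_zero`,
`planeIndex_conwayNorton_ne_zero_of_isIsogenous_quadraticTwist_negThree`,
**`eisensteinDepth_le_of_isIsogenous_quadraticTwist_negThree'`** (guard-free: `k(D.f) ≤ 2·ord₃ r_R(D.f) ≤ 2·ord₃ r_{D.f}`).

BSD is not proved by this; Manin's conjecture is not proved by this.
-/

set_option autoImplicit false
set_option linter.dupNamespace false

noncomputable section

open scoped MatrixGroups ModularForm
open CongruenceSubgroup WeierstrassCurve
open Literature.NumberTheory.EllipticCurves Literature.NumberTheory.EllipticCurves.ModularForms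
open Summit.BirchSwinnertonDyer.Rank1Residual.ManinAdditive
open Summit.BirchSwinnertonDyer.Rank1Residual.ManinAdditive.RamanujanCut
open Summit.BirchSwinnertonDyer.Rank1Residual.ManinAdditive.ConwayCut
open Summit.BirchSwinnertonDyer.Rank1Residual.ManinAdditive.ConwayNortonThree

namespace Summit.BirchSwinnertonDyer.BirchSwinnertonDyer.Theorems.ManinLocalTwoThree

variable {N : ℕ} [NeZero N] {W : WeierstrassCurve ℚ} [W.IsElliptic]

omit [W.IsElliptic] in
/-- **`r_f ≠ 0` for the newform of a modular parametrisation datum** (Pasten–Shimura: `r_f ∣ ∏ η_f(P) > 0`). -/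
theorem congruenceNumber_ne_zero_of_datum (D : ModularParametrizationData W N) : congruenceNumber D.f ≠ 0 := fun h0 =>
  (Nat.pos_iff_ne_zero.mp D.prod_heckeCongruenceModulus_pos)
    (Nat.eq_zero_of_zero_dvd (h0 ▸ D.congruenceNumber_dvd_prod_heckeCongruenceModulus))

omit [W.IsElliptic] in
/-- Every line index of an integral lattice containing `D.f` is nonzero (finite). -/
theorem lineIndex_ne_zero_of_mem (D : ModularParametrizationData W N) {M : Submodule ℤ (CuspForm (Gamma0 N) 2)}
    (hM : M ≤ integralCuspForms0 N 2) (hf : D.f ∈ M) : lineIndex M D.f ≠ 0 := fun h0 =>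
  congruenceNumber_ne_zero_of_datum D
    (Nat.eq_zero_of_zero_dvd (h0 ▸ (lineIndex_integralCuspForms0 D.f ▸ lineIndex_dvd_of_le hM hf)))

/-- `r_R(D.f) ≠ 0` (`9 ∣ N`). -/
theorem lineIndex_ramanujan_ne_zero (h9 : 9 ∣ N) (D : ModularParametrizationData W N) :
    lineIndex (ramanujanStableLattice N) D.f ≠ 0 :=
  lineIndex_ne_zero_of_mem D (ramanujanStableLattice_le_alStableLattice.trans alStableLattice_le)
    (f_mem_ramanujanStableLattice h9 D)

/-- `r_G(D.f) ≠ 0` (`4 ∣ N`). -/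
theorem lineIndex_conway_ne_zero (h4 : 4 ∣ N) (D : ModularParametrizationData W N) :
    lineIndex (conwayStableLattice N) D.f ≠ 0 :=
  lineIndex_ne_zero_of_mem D conwayStableLattice_le (f_mem_conwayStableLattice h4 D)

omit [W.IsElliptic] in
/-- `r_{AL}(D.f) ≠ 0`. -/
theorem lineIndex_al_ne_zero (D : ModularParametrizationData W N) : lineIndex (alStableLattice N) D.f ≠ 0 :=
  lineIndex_ne_zero_of_mem D alStableLattice_le
    (f_mem_alStableLattice D IsNewform0.exists_atkinLehnerInvolutionAt_eq_smul_holds)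

/-- **The Conway–Norton plane index of a same-conductor `(−3)`-twist pair is finite**: `planeIndex(M^G, D.f) ≠ 0`
(it divides `r_R(D.f)² ≠ 0`). -/
theorem planeIndex_conwayNorton_ne_zero_of_isIsogenous_quadraticTwist_negThree {W' : WeierstrassCurve ℚ} [W'.IsElliptic]
    (D : ModularParametrizationData W N) (D' : ModularParametrizationData W' N) (h9 : 9 ∣ N)
    (h9W' : 9 ∣ W'.conductorNorm ℤ) (hiso : IsIsogenous (W.quadraticTwist ((-3 : ℤ) : ℚ)) W') :
    planeIndex (conwayNortonLatticeAtThree N) D.f ≠ 0 := fun h0 =>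
  pow_ne_zero 2 (lineIndex_ramanujan_ne_zero h9 D)
    (Nat.eq_zero_of_zero_dvd (h0 ▸ planeIndex_conwayNorton_dvd_sq_lineIndex_ramanujan h9
      (mem_conwayNorton_of_isIsogenous_quadraticTwist_negThree D D' (by simpa using h9) h9W' hiso).1))

/-- **Guard-free upper half of E-desc-56 for same-conductor `(−3)`-twist pairs**: `k(D.f) ≤ 2·ord₃ r_R(D.f)` and
`k(D.f) ≤ 2·ord₃ r_{D.f}`. -/
theorem eisensteinDepth_le_of_isIsogenous_quadraticTwist_negThree' {W' : WeierstrassCurve ℚ} [W'.IsElliptic]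
    (D : ModularParametrizationData W N) (D' : ModularParametrizationData W' N) (h9 : 9 ∣ N)
    (h9W' : 9 ∣ W'.conductorNorm ℤ) (hiso : IsIsogenous (W.quadraticTwist ((-3 : ℤ) : ℚ)) W') :
    eisensteinDepth (conwayNortonLatticeAtThree N) D.f ≤ 2 * padicValNat 3 (lineIndex (ramanujanStableLattice N) D.f) ∧
      eisensteinDepth (conwayNortonLatticeAtThree N) D.f ≤ 2 * padicValNat 3 (congruenceNumber D.f) :=
  ⟨(eisensteinDepth_le_of_isIsogenous_quadraticTwist_negThree D D' h9 h9W' hiso (lineIndex_ramanujan_ne_zero h9 D)).2,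
    eisensteinDepth_le_congruenceNumber_of_isIsogenous_quadraticTwist_negThree D D' h9 h9W' hiso
      (congruenceNumber_ne_zero_of_datum D)⟩

end Summit.BirchSwinnertonDyer.BirchSwinnertonDyer.Theorems.ManinLocalTwoThree

end
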